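import Summits.RiemannHypothesis.RiemannHypothesis.Theorems.GroundBartaEvenWinsBeyondArchDeflationWindowConst
import Summits.RiemannHypothesis.RiemannHypothesis.Theorems.GroundBartaEvenWinsBeyondArchDeflationFourPrimeWindow
import HarnessLib

/-!
# RiemannHypothesis / GroundBarta — rung 4 (`EvenWinsBeyondArch`, stmt-RiemannHypothesis-18807 / 18085):
# the deflated Temple L-side beyond `(log 5)/2` — window constants of the R-layer on the `{2,3,4,5}`-window (four slots)

Helper file (`--supports stmt-RiemannHypothesis-18085`), RH-free.  Prover A g12 (unit `sr-gb-rung-a`), seed of the FOUR-slot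
R-layer needed by the cells beyond the three-prime endpoint (first target `c = 83/100`, DESIGN-BEYOND-LOG5HALF.md §8): the three-slot
stack (`dt_threeWindowCheck` / `dt_hprimes_three` / `dt_WinL` of …WindowConst, …WindowGlue, …PanelForm, …PanelQLoc1–4, …CrossPanels,
…WeightedPanels; prover B) covers `log 2 < c ≤ (log 5)/2`.  Here:

* `dt_fourWindowCheck` / `dt_fourWindow_sound` — `(log 5)/2 < c ≤ (log 7)/2` certified from the kernel enclosures of `log 5`, `log 7`;
* `dt_hprimes_four` — the FOUR-slot form of the prime sum of a window image on the `{2,3,4,5}`-window: slots `(log 2/√2, log 2)`,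
  `(log 3/√3, log 3)`, `(log 2/2, log 4)`, `(log 5/√5, log 5)` (`dt_fp_sum_weilPrimeIndex`);
* `dt_hprimes_four_of_three` — the same sum as the THREE-slot expression plus the single new slot, for generators that extend the
  three-slot residual by one shift.

The four-slot window bundle `dt_WinL4` and its panel lemmas are NOT in this file (open engineering item; HOME(A)/STATUS 2026-08-22).
-/

set_option linter.dupNamespace false

noncomputable section

open MeasureTheory Set Filter Finset
open scoped Topology BigOperators

namespace Summit.RiemannHypothesis.RiemannHypothesis.Theorems.EvenWinsBeyondArch

open Literature.NumberTheory.LFunctions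
open Literature.Analysis.ValidatedNumerics Literature.Analysis.ValidatedNumerics.PolyMP
  Literature.Analysis.ValidatedNumerics.NumericsMP Literature.Analysis.ValidatedNumerics.ExpPoly

/-- `(log 5)/2 < c ≤ (log 7)/2`, certified from the kernel enclosures of `log 5`, `log 7`. [folklore] -/
def dt_fourWindowCheck (S K : ℕ) (c : ℚ) : Bool :=
  match MI.logNat S K 5, MI.logNat S K 7 with
  | some A, some B => decide ((A.hi : ℚ) < 2 * c * S) && decide (2 * (c : ℚ) * S ≤ B.lo)
  | _, _ => false

/-- Soundness of `dt_fourWindowCheck`. [folklore] -/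
theorem dt_fourWindow_sound {S : ℕ} (hS : 0 < S) {K : ℕ} {c : ℚ} (h : dt_fourWindowCheck S K c = true) :
    Real.log 5 / 2 < (c : ℝ) ∧ (c : ℝ) ≤ Real.log 7 / 2 := by
  unfold dt_fourWindowCheck at h
  cases hA : MI.logNat S K 5 with
  | none => simp [hA] at h
  | some A =>
    cases hB : MI.logNat S K 7 with
    | none => simp [hA, hB] at h
    | some B =>
      simp only [hA, hB, Bool.and_eq_true, decide_eq_true_eq] at h
      have hSr : (0 : ℝ) < S := by exact_mod_cast hS
      obtain ⟨_, h5hi⟩ := MI.mem_logNat hS hA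
      obtain ⟨h7lo, _⟩ := MI.mem_logNat hS hB
      have e1 : ((A.hi : ℚ) : ℝ) < 2 * c * S := by exact_mod_cast h.1
      have e2 : 2 * (c : ℝ) * S ≤ ((B.lo : ℚ) : ℝ) := by exact_mod_cast h.2
      push_cast at e1 e2 h5hi h7lo
      constructor
      · have : Real.log 5 * S < 2 * c * S := by linarith
        have := lt_of_mul_lt_mul_right this hSr.le
        linarith
      · have : 2 * (c : ℝ) * S ≤ Real.log 7 * S := by linarith
        have := le_of_mul_le_mul_right this hSr
        linarith

/-- **Four-slot form of the prime sum on a `{2,3,4,5}`-window** (`(log 5)/2 < c ≤ (log 7)/2`): slots `(log 2/√2, log 2)`,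
`(log 3/√3, log 3)`, `(log 2/2, log 4)`, `(log 5/√5, log 5)`. [cite: Bombieri2000Weil, Thm 2 (prime term)] -/
theorem dt_hprimes_four {c : ℝ} (hb : Real.log 5 / 2 < c) (hb2 : c ≤ Real.log 7 / 2) (g G : ℝ → ℝ) (y : ℝ) :
    ∑ n ∈ weilPrimeIndex c, ((ArithmeticFunction.vonMangoldt n : ℝ) / Real.sqrt n) *
        (2 * g y - G (y - Real.log n) - G (y + Real.log n)) =
      Real.log 2 / Real.sqrt 2 * (2 * g y - G (y - Real.log 2) - G (y + Real.log 2)) +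
        Real.log 3 / Real.sqrt 3 * (2 * g y - G (y - Real.log 3) - G (y + Real.log 3)) +
        Real.log 2 / 2 * (2 * g y - G (y - Real.log 4) - G (y + Real.log 4)) +
        Real.log 5 / Real.sqrt 5 * (2 * g y - G (y - Real.log 5) - G (y + Real.log 5)) := by
  rw [dt_fp_sum_weilPrimeIndex hb hb2]
  push_cast
  ring

/-- The four-slot prime sum as the three-slot expression of the `{2,3,4}`-machinery plus the new slot `(log 5/√5, log 5)`.
[folklore] -/
theorem dt_hprimes_four_of_three {c : ℝ} (hb : Real.log 5 / 2 < c) (hb2 : c ≤ Real.log 7 / 2) (g G : ℝ → ℝ) (y : ℝ) :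
    ∑ n ∈ weilPrimeIndex c, ((ArithmeticFunction.vonMangoldt n : ℝ) / Real.sqrt n) *
        (2 * g y - G (y - Real.log n) - G (y + Real.log n)) =
      (Real.log 2 / Real.sqrt 2 * (2 * g y - G (y - Real.log 2) - G (y + Real.log 2)) +
        Real.log 3 / Real.sqrt 3 * (2 * g y - G (y - Real.log 3) - G (y + Real.log 3)) +
        Real.log 2 / 2 * (2 * g y - G (y - Real.log 4) - G (y + Real.log 4))) +
        Real.log 5 / Real.sqrt 5 * (2 * g y - G (y - Real.log 5) - G (y + Real.log 5)) := by
  rw [dt_hprimes_four hb hb2]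

/-- On `[0, c)` the forward shift by `log 5` leaves the window: for `0 ≤ y` and `c ≤ (log 7)/2 < log 5`, `c < y + log 5`, so a
vector cut at `c` vanishes at `y + log 5`. [folklore] -/
theorem dt_window_lt_add_log_five {c y : ℝ} (hc7 : c ≤ Real.log 7 / 2) (hy : 0 ≤ y) : c < y + Real.log 5 := by
  have h7 : Real.log 7 < Real.log 25 := Real.log_lt_log (by norm_num) (by norm_num)
  have h25 : Real.log 25 = 2 * Real.log 5 := by
    rw [show (25 : ℝ) = 5 ^ 2 by norm_num, Real.log_pow]; push_cast; ring
  linarith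

/-- The backward shift by `log 5` meets the window `[-c, c]` only in the outer sliver: for `y < log 5 − c`,
`y − log 5 < -c`, so a vector cut at `c` vanishes at `y − log 5`. [folklore] -/
theorem dt_sub_log_five_lt_neg {c y : ℝ} (hy : y < Real.log 5 - c) : y - Real.log 5 < -c := by linarith

end Summit.RiemannHypothesis.RiemannHypothesis.Theorems.EvenWinsBeyondArch

end
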